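import Summits.BirchSwinnertonDyer.BirchSwinnertonDyer.Theorems.ThetaPartnerAtTwoSignedKatoUpToAtTwoFlatEqualsPlus
import Summits.BirchSwinnertonDyer.BirchSwinnertonDyer.Theorems.ThetaPartnerAtTwoSignedKatoUpToAtTwoFlatSelmerPlus
import Summits.BirchSwinnertonDyer.BirchSwinnertonDyer.Theorems.ThetaPartnerAtTwoSignedTransportAtTwoSignedSelmerDescription
import Summits.BirchSwinnertonDyer.BirchSwinnertonDyer.Theorems.PrintX8VSInputHondaSystemPrimalPadic
import Summits.BirchSwinnertonDyer.BirchSwinnertonDyer.Theorems.PrintX8VSInputHondaSystemPrimalTransport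
import Summits.BirchSwinnertonDyer.BirchSwinnertonDyer.Theorems.PrintX8VSInputHondaSystemDualClauses
import Literature.NumberTheory.EllipticCurves.Sprung2012.LocalTowerNoPTorsionProofs
import Literature.NumberTheory.EllipticCurves.CyclotomicZpExtensionLocalGeneratorProofs
import Summits.BirchSwinnertonDyer.BirchSwinnertonDyer.Theorems.SignedLowerHalvesBDKimSignedCharValueRankZeroOfChromatic
import HarnessLib

/-!
# AT AN ODD SUPERSINGULAR PRIME WITH `a_p = 0`, KOBAYASHI's `Sel⁺(E/ℚ_∞)` IS SPRUNG's `Sel♭(E/ℚ_∞)` — unconditionally, for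
# the Honda system of Sprung's Thm. 2.2 (tree theorem of seat honda-p1): the `ε = +1` half of the TRANSPORT identity under
# B. D. Kim 2013 Cor. 3.15 (`BDKim2013.cor315_signedCharValue_rankZero`, item stmt-BirchSwinnertonDyer-19288 BY NAME)

LADDER-BSD D-0154 (2) INPUTS→UNCONDITIONAL, INPUTS-LIST-2 row F10 (ADDENDUM-5 §C, tranche T2b), seat `bsd-inputs-kim315-p1` (gen 2);
`--supports` stmt-BirchSwinnertonDyer-19288. Sequel of `…Theorems/SignedLowerHalvesBDKimSignedCharValueRankZeroOfChromatic.lean`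
(`KimCor315.cor315_of_poitouTate_of_signedEqChromatic : PT-Sel → PT-Ш → PT3ℝ → PT2ℝ → TRANSPORT → BDKim2013.cor315_…`, whose
hypothesis TRANSPORT asks, for every sign `ε` and every `(W, p, κ, v)`, for a local generator lift `g`, a Honda system `(cneg, c)`
and a colour `col` with `Kobayashi2003.signedSelmerInfty W κ ε = Sprung2012.sharpFlatSelmerInfty W κ (closureEmb ℚ_v) a_p g c col`).
THIS FILE discharges TRANSPORT for `ε = 1` (colour `♭`) at every odd supersingular prime with `a_p = 0`, with NO displayed
hypothesis (§4). HONEST FRAMING: THEOREMS ONLY (no definition, no named fact, no instance, no `sorry`); route-independent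
(no `Theses` import); closes nothing; the `ε = −1` half (colour `♯`) is NOT here; BSD is not proved by any of this.

## The argument

The TP2 width seat proved, for ANY base and prime, `Sel⁺ ≤ Sel♭` (`SignedKatoOffTwo.FlatKernel.signedSelmerInfty_le_sharpFlatSelmerInfty_flat`:
`Ker Col♭` kills `⨆ₙ E⁺(K_n·K_v)`, Kobayashi Prop. 8.18–8.23 on the functional model) and the converse LOCAL inclusion
(`…conjH1_mem_localKummerOverOfEmb_iSup_plus_of_mem_sharpFlatSelmerInfty`: the ♭ condition — exact annihilator of `Ker Col♭`,
Sprung Def. 7.9 — implies the plus Kummer condition over `K_∞`), modulo: a local lift `g` of the topological generator; (NT) no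
`p`-torsion in `E(K_∞·K_v)`; (IDX) layer degrees `p`; and a Honda system `d` «of `a_p = 0` shape» with PRIMAL generation clauses
(L) (TR) (GEN) (GEN₀); and closed the identity at `p = 2` (`signedSelmerInfty_eq_sharpFlatSelmerInfty_flat_two`) with tp2-p1's
descent of the local conditions to a finite layer (`SignedTransportAtTwo.mem_signedSelmerInfty_of_mem_selmerInfty`, `p = 2`, `ε = 1`).
At an ODD prime every input is now a tree theorem: `g` exists (`ZpExtension.IsCyclotomic.exists_isTopGenerator_resGalOfEmb_adicCompletion`),
(NT) is Sprung's Lemma 2.3 (`Sprung2012.eq_zero_of_mem_localTowerPointsOfEmb_of_prime_nsmul`), (IDX) is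
`SignedEC.index_subgroupOf_localLayerSubgroupOfEmb_succ_eq`, and the primal Honda data — levels, Sprung's relations
`c₀ = (a_p − 2)c_{−1}`, `Tr_{n+1/n} c_{n+1} = a_p c_n − c_{n−1}`, generation with a multiplier `N` prime to `p` — is seat honda-p1's
`SprungHonda.exists_primalHonda_padic` / `primalHonda_adicCompletion_of_padic` (Sprung Thm. 2.2, Kobayashi §8), which also yields
`IsHondaSystem` (`SprungHonda.isHondaSystem_of_primal`). §1 ports the descent lemma to any `p` and sign (verbatim argument); §2
converts the multiplier-`N` generation clauses into the TP2 shape (`E(K_m·K_v)/S` is killed by `N` and by `p`, hence trivial; at level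
`0`, `c₀ = −2c_{−1}` and `2 ∈ ℤ_pˣ` for odd `p`); §3 is the odd-`p` twin of `signedSelmerInfty_eq_sharpFlatSelmerInfty_flat_two`; §4
assembles the `ε = 1` instance of TRANSPORT with its Honda system.

## What is proved

* §1 `mem_signedSelmerInfty_of_mem_selmerInfty_of_kummer` (`K = ℚ`, any `p`, any `ℤ_p`-extension, any sign): a class of
  `Sel_{p^∞}(E/ℚ_∞)` which is signed-Kummer above `p` w.r.t. `⨆ₙ E^ε(ℚ_{n,p})` lies in `Sel^ε(E/ℚ_∞)`.
* §2 `gen_of_gen_nsmul`, `gen_zero_of_gen_zero_nsmul` (any `K`, `E`, `ι`): TP2-shape (GEN), (GEN₀) from the multiplier-`N` clauses.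
* §3 **`signedSelmerInfty_one_eq_sharpFlatSelmerInfty_flat_odd`**: `Sel⁺(E/ℚ_∞) = Sel♭(E/ℚ_∞)` at an odd good `p` with `p ∣ a_p`,
  cyclotomic `κ`, modulo a TP2-shape Honda system `d` and `g` (the odd twin of `…_flat_two`; (NT), (IDX) discharged).
* §4 **`exists_isHondaSystem_signedSelmerInfty_one_eq_flat`**: for `W/ℚ` globally minimal, `p ≠ 2` good with `a_p = 0`, `κ`
  cyclotomic, `v ∋ p`: `∃ g cneg c, IsTopGenerator (res g) ∧ IsHondaSystem κ (closureEmb ℚ_v) W a_p g cneg c ∧ Sel⁺_∞ = Sel♭_∞`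
  — the `ε = 1` instance of TRANSPORT, unconditionally.
* §5 **`cor315_plus_of_cassels_of_poitouTate`, `cor315_plus_of_poitouTate`**: Cor. 3.15 for the sign `+` (the body of the fact at
  `ε = 1`, every datum) ⟸ {CASSELS | PT-Sel, PT-Ш, PT3ℝ, PT2ℝ} — no `±`-specific input left for the plus sign.

References: [Sprung2012] F. Sprung, J. Number Theory 132 (2012), §1 p. 1486, Thm. 2.2, Lemma 2.3, Def. 7.9–7.11; [Kobayashi2003]
S. Kobayashi, Invent. Math. 152 (2003), Def. 1.1, Thm. 6.2, Prop. 8.12, Prop. 8.18–8.23; [GreenbergLNM1716] §3 Lemmas 3.2–3.3;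
[BDKim2013] Cor. 3.15. Credit: seats tp2-p2x-w2 / tp2-p1 (the generic TP2 theorems and the `p = 2` descent), honda-p1 (primal
Honda data), the `bsd-ssimc` typists (Lemma 2.3) — all consumed here at odd `p`.
-/

set_option autoImplicit false
-- the Theorems namespace of this sub repeats the summit name by design (D-0017 nested layout)
set_option linter.dupNamespace false

noncomputable section

open scoped Classical AddSubgroup

open WeierstrassCurve NumberField IsDedekindDomain Field Literature Literature.NumberTheory.EllipticCurves
  Literature.NumberTheory.GaloisRepresentations Literature.NumberTheory.EllipticCurves.Kobayashi2003 ZpExtension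
  Literature.NumberTheory.EllipticCurves.GreenbergVatsal2000 Literature.NumberTheory.EllipticCurves.GreenbergSelmer
  Literature.NumberTheory.EllipticCurves.Rank1Residual Literature.NumberTheory.EllipticCurves.Sprung2017
  Literature.NumberTheory.EllipticCurves.Sprung2012
  Summit.BirchSwinnertonDyer.Rank1Residual.Additive
  Summit.BirchSwinnertonDyer.Rank1Residual.X2.GreenbergVatsalUnramifiedAway
  Summit.BirchSwinnertonDyer.BirchSwinnertonDyer.Theorems.FineSelmerLeSignedSelmer
  Summit.BirchSwinnertonDyer.BirchSwinnertonDyer.Theorems.SignedTransportAtTwo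
  Summit.BirchSwinnertonDyer.BirchSwinnertonDyer.Theorems.SignedKatoOffTwo.FlatKernel

universe u

namespace Summit.BirchSwinnertonDyer.BirchSwinnertonDyer.Theorems.KimCor315

/-! ## §1 Descent of the signed Kummer condition to a finite layer (any `p`, any sign) -/

section Descent

variable (W : WeierstrassCurve ℚ) [W.IsElliptic] {p : ℕ} [hp : Fact p.Prime] (κ : ZpExtension ℚ p) (ε : ℤˣ)

-- adapted from `SignedTransportAtTwo.mem_signedSelmerInfty_of_mem_selmerInfty` (tp2-p1, `p = 2`, `ε = 1`): same argument verbatim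
/-- **Descent: `Sel_{p^∞}(E/ℚ_∞) ∩ {ε-signed-Kummer above p} ≤ Sel^ε(E/ℚ_∞)`** for any `E/ℚ`, any prime `p`, any `ℤ_p`-extension `κ`
and either sign. A class `s = hₙ(y)` of `Sel(E/ℚ_∞)` whose conjugates are Kummer above `p` w.r.t. `⨆ₘ E^ε(ℚ_{m,p})`: the classical
conditions of the `pⁿ` conjugates `conj_{γ^i} y` at the places of `S = {bad places} ∪ {v ∣ p}` and the signed Kummer witnesses descend
to one layer `m ≥ n` (`exists_forall_resOfLe_localSubgroup_eq_zero_of_mem_localTowerKer`,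
`exists_forall_conjH1_resOfLe_mem_localKummerOverOfEmb`); off `S` and at `∞` they hold at every layer (Greenberg's Lemma 3.3,
archimedean splitting); so `res_{ℚ_m/ℚ_n} y ∈ Sel^ε(E/ℚ_m)` (Kobayashi's Def. 1.1 at layer `m`) and `s = h_m(res y) ∈ Sel^ε(E/ℚ_∞)`.
[cite: Kobayashi2003, Def. 1.1] [cite: GreenbergLNM1716, §3 Lemmas 3.2–3.3 (pp. 86–88)] -/
theorem mem_signedSelmerInfty_of_mem_selmerInfty_of_kummer (s : W.subgroupH1 p κ.kerSubgroup) (hsel : s ∈ W.selmerInfty κ)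
    (hc : ∀ (v : HeightOneSpectrum (𝓞 ℚ)), ((p : ℕ) : 𝓞 ℚ) ∈ v.asIdeal → ∀ σ : Field.absoluteGaloisGroup ℚ,
      W.conjH1 p κ.kerSubgroup σ s ∈
        localKummerOverOfEmb W p κ.kerSubgroup (closureEmb (K := ℚ) (v.adicCompletion ℚ))
          (⨆ n : ℕ, signedLocalPoints κ (v.adicCompletion ℚ) W ε n)) :
    s ∈ signedSelmerInfty W κ ε := by
  -- `s = hₙ(y)`; a topological generator `γ`
  obtain ⟨n, y, hy⟩ := exists_layerToInfty_eq W κ s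
  obtain ⟨γ, hγ⟩ := κ.surjective (Multiplicative.ofAdd 1)
  have hγ' : κ.IsTopGenerator γ := hγ
  have hyA : y ∈ W.selmerInftyPreimage κ n := by
    rw [W.mem_selmerInftyPreimage_iff κ n y, hy]; exact hsel
  -- the finite set `S = {bad places of E} ∪ {v ∣ p}`
  have hT : ({v : HeightOneSpectrum (𝓞 ℚ) | ((p : ℕ) : 𝓞 ℚ) ∈ v.asIdeal}).Finite :=
    BigGaloisRep.finite_setOf_natCast_mem_asIdeal (K := ℚ) hp.out.ne_zero
  haveI : Fintype {v : HeightOneSpectrum (𝓞 ℚ) // ((p : ℕ) : 𝓞 ℚ) ∈ v.asIdeal} := hT.fintype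
  have hB : (W.badPlaces (𝓞 ℚ)).Finite := W.finite_badPlaces_holds (𝓞 ℚ)
  set S : Finset (HeightOneSpectrum (𝓞 ℚ)) := hB.toFinset ∪ hT.toFinset with hSdef
  have hS : ∀ v ∉ S, ((p : ℕ) : 𝓞 ℚ) ∉ v.asIdeal ∧ W.HasGoodReductionAt v := by
    intro v hv
    rw [hSdef, Finset.mem_union, not_or, Set.Finite.mem_toFinset, Set.Finite.mem_toFinset, Set.mem_setOf_eq] at hv
    refine ⟨hv.2, ?_⟩
    by_contra h
    exact hv.1 h
  -- descent of the classical local conditions at the places of `S`, for the `pⁿ` conjugates `conj_{γ^i} y`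
  have hcl := fun (vi : ↥S × Fin (p ^ n)) ↦
    exists_forall_resOfLe_localSubgroup_eq_zero_of_mem_localTowerKer W κ (vi.1.1.adicCompletion ℚ) n
      (W.localResOver_conjH1_mem_localTowerKer_of_mem κ hyA vi.1.1 (γ ^ (vi.2 : ℕ)))
  choose mc hmc using hcl
  -- descent of the signed Kummer witnesses at the places above `p`, for the same conjugates
  have hku := fun (vi : {v : HeightOneSpectrum (𝓞 ℚ) // ((p : ℕ) : 𝓞 ℚ) ∈ v.asIdeal} × Fin (p ^ n)) ↦
    exists_forall_conjH1_resOfLe_mem_localKummerOverOfEmb W κ (vi.1.1.adicCompletion ℚ)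
      (fun m ↦ signedLocalPoints κ (vi.1.1.adicCompletion ℚ) W ε m)
      (signedLocalPointsOfEmb_mono κ (closureEmb (K := ℚ) (vi.1.1.adicCompletion ℚ)) W ε) y (γ ^ (vi.2 : ℕ))
      (by rw [hy]; exact hc vi.1.1 vi.1.2 _)
  choose mk hmk using hku
  -- one layer `m` past all of them
  set m : ℕ := max n (max (Finset.univ.sup mc) (Finset.univ.sup mk)) with hm
  have hnm : n ≤ m := le_max_left _ _
  have hmc' : ∀ vi, mc vi ≤ m := fun vi ↦
    (Finset.le_sup (Finset.mem_univ vi)).trans ((le_max_left _ _).trans (le_max_right _ _))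
  have hmk' : ∀ vi, mk vi ≤ m := fun vi ↦
    (Finset.le_sup (Finset.mem_univ vi)).trans ((le_max_right _ _).trans (le_max_right _ _))
  set ym : W.subgroupH1 p (κ.layerSubgroup m) := W.resOfLe p (κ.layerSubgroup_antitone hnm) y with hym
  have hcm : W.layerToInfty κ m ym = W.layerToInfty κ n y := layerToInfty_resOfLe_layer W κ hnm y
  have hymA : ym ∈ W.selmerInftyPreimage κ m := by
    rw [W.mem_selmerInftyPreimage_iff, hcm, hy]; exact hsel
  -- `res_{ℚ_m/ℚ_n} y ∈ Sel^ε(E/ℚ_m)`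
  have hmem : ym ∈ signedSelmerLayer W κ ε m := by
    rw [mem_signedSelmerLayer_iff]
    constructor
    · -- the classical local conditions at layer `m`
      change ym ∈ W.selmerGroupOver p (κ.layerSubgroup m)
      rw [WeierstrassCurve.mem_selmerGroupOver_iff]
      refine ⟨fun v σ ↦ ?_, fun w σ ↦ ?_⟩
      · rw [WeierstrassCurve.mem_localKerOver_iff]
        by_cases hv : v ∈ S
        · -- descended from `ℚ_∞`
          obtain ⟨i, hi, hiσ⟩ := exists_conjH1_eq_conjH1_pow_of_lt W κ hγ' n σ y
          rw [hym, conjH1_resOfLe_layer W κ hnm, hiσ, localResOver_resOfLe_layer W κ hnm]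
          exact hmc (⟨v, hv⟩, ⟨i, hi⟩) m hnm (hmc' _)
        · -- good `v ∉ S`, `v ∤ p`: `𝒦_{v,m}[p^∞] = 0` (Greenberg's Lemma 3.3)
          have hK := W.localResOver_conjH1_mem_localTowerKer_of_mem κ hymA v σ
          obtain ⟨k, hk⟩ := W.exists_pow_smul_subgroupH1_layer_eq_zero κ m (W.conjH1 p (κ.layerSubgroup m) σ ym)
          have hprim : W.localResOver p (κ.layerSubgroup m) (v.adicCompletion ℚ)
              (W.conjH1 p (κ.layerSubgroup m) σ ym) ∈ W.localTowerKerPrimary κ (v.adicCompletion ℚ) m :=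
            (W.mem_localTowerKerPrimary_iff κ _ m _).2 ⟨hK, k, by rw [← map_nsmul, hk, map_zero]⟩
          rw [Greenberg1999.localTowerKerPrimary_eq_bot_of_hasGoodReductionAt W κ (hS v hv).1 (hS v hv).2 m,
            AddSubgroup.mem_bot] at hprim
          exact hprim
      · -- archimedean places split completely
        rw [WeierstrassCurve.mem_localKerOver_iff]
        have hK := W.localResOver_conjH1_mem_localTowerKer_of_mem_infinitePlace κ hymA w σ
        rw [W.localTowerKer_eq_bot_of_forall_mem κ w.Completion m
          (ZpExtension.resGal_infinitePlace_mem_kerSubgroup κ w), AddSubgroup.mem_bot] at hK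
        exact hK
    · -- the signed Kummer conditions at `v ∣ p`: descended witnesses
      intro v hv σ
      obtain ⟨i, hi, hiσ⟩ := exists_conjH1_eq_conjH1_pow_of_lt W κ hγ' n σ y
      rw [hym, conjH1_resOfLe_layer W κ hnm, hiσ, ← conjH1_resOfLe_layer W κ hnm]
      exact hmk (⟨⟨v, hv⟩, ⟨i, hi⟩⟩) m hnm (hmk' _)
  -- `s = h_m(res y) ∈ ⋃ₙ hₙ(Sel^ε(E/ℚ_n))`
  rw [← hy, ← hcm]
  exact map_layerToInfty_signedSelmerLayer_le W κ ε m ⟨ym, hmem, rfl⟩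

end Descent

/-! ## §2 The TP2-shape generation clauses from the multiplier-`N` clauses (any base) -/

section Clauses

variable {K : Type u} [Field K] {p : ℕ} [hp : Fact p.Prime] (κ : ZpExtension K p)
variable {E : Type u} [Field E] [Algebra K E] (ι : AlgebraicClosure K →ₐ[K] AlgebraicClosure E) (W : WeierstrassCurve K)

omit hp in
/-- Bézout for `N` prime to `p`: `1 = N·a + p·b` in `ℤ`. [folklore] -/
theorem exists_int_combination_eq_one_of_coprime {N : ℕ} (hN : N.Coprime p) :
    ∃ a b : ℤ, (N : ℤ) * a + (p : ℤ) * b = 1 := by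
  refine ⟨Nat.gcdA N p, Nat.gcdB N p, ?_⟩
  have h := Nat.gcd_eq_gcd_ab N p
  rw [Nat.Coprime.gcd_eq_one hN] at h
  exact_mod_cast h.symm

/-- **(GEN) in TP2 shape from generation with a multiplier `N` prime to `p`** (Sprung Cor. 2.10 / Kobayashi Prop. 8.12 ii) as seat
honda-p1 states it): if `N·E(K_m·K_v) ⊆ ℤ[Γ·c_m] + E(K_{m−1}·K_v) + p·E(K_m·K_v)` then already
`E(K_m·K_v) = ℤ[Γ·c_m] + E(K_{m−1}·K_v) + p·E(K_m·K_v)` — the quotient is killed by `N` and by `p`, hence by `1`.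
[cite: Sprung2012, Cor. 2.10 (p. 1489)] [cite: Kobayashi2003, Prop. 8.12 ii) (p. 17)] -/
theorem gen_of_gen_nsmul {N : ℕ} (hN : N.Coprime p) {c : ℕ → localPoints W E}
    (hGEN : ∀ m : ℕ, 1 ≤ m → ∀ P ∈ localLayerPointsOfEmb κ ι W m,
      ∃ B ∈ AddSubgroup.closure (Set.range fun σ : Field.absoluteGaloisGroup E ↦ σ • c m),
        ∃ P' ∈ localLayerPointsOfEmb κ ι W (m - 1), ∃ R ∈ localLayerPointsOfEmb κ ι W m, N • P = B + P' + p • R) :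
    ∀ m : ℕ, 1 ≤ m → ∀ P ∈ localLayerPointsOfEmb κ ι W m,
      ∃ B ∈ AddSubgroup.closure (Set.range fun σ : Field.absoluteGaloisGroup E ↦ σ • c m),
        ∃ P' ∈ localLayerPointsOfEmb κ ι W (m - 1), ∃ R ∈ localLayerPointsOfEmb κ ι W m, P = B + P' + p • R := by
  intro m hm P hP
  obtain ⟨B, hB, P', hP', R, hR, h⟩ := hGEN m hm P hP
  obtain ⟨a, b, hab⟩ := exists_int_combination_eq_one_of_coprime hN
  refine ⟨a • B, AddSubgroup.zsmul_mem _ hB a, a • P', AddSubgroup.zsmul_mem _ hP' a, a • R + b • P,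
    add_mem (AddSubgroup.zsmul_mem _ hR a) (AddSubgroup.zsmul_mem _ hP b), ?_⟩
  have key : P = a • (N • P) + b • (p • P) := by
    conv_lhs => rw [← one_zsmul P, ← hab]
    rw [add_zsmul, mul_comm (N : ℤ) a, mul_zsmul, natCast_zsmul, mul_comm (p : ℤ) b, mul_zsmul, natCast_zsmul]
  conv_lhs => rw [key, h]
  module

/-- **(GEN₀) in TP2 shape at `a_p = 0`, odd `p`** — `E(K_v) = ℤ·c₀ + p·E(K_v)` with `c₀ = (a_p − 2)c_{−1} = −2c_{−1}` — from generation
by `c_{−1}` with a multiplier `N` prime to `p`: remove `N` as in `gen_of_gen_nsmul`, and `c_{−1} = t·c₀ + p·c_{−1}` for `p = 2t + 1`.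
[cite: Sprung2012, Thm. 2.2 (p. 1487)] [cite: Kobayashi2003, Prop. 8.12 ii) (p. 17)] -/
theorem gen_zero_of_gen_zero_nsmul (hp2 : p ≠ 2) {N : ℕ} (hN : N.Coprime p) {cneg : localPoints W E} {c : ℕ → localPoints W E}
    (hcneg : cneg ∈ localLayerPointsOfEmb κ ι W 0) (hR0 : c 0 = (-2 : ℤ) • cneg)
    (hGEN0 : ∀ P ∈ localLayerPointsOfEmb κ ι W 0, ∃ u : ℤ, ∃ R ∈ localLayerPointsOfEmb κ ι W 0, N • P = u • cneg + p • R) :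
    ∀ P ∈ localLayerPointsOfEmb κ ι W 0, ∃ a : ℤ, ∃ R ∈ localLayerPointsOfEmb κ ι W 0, P = a • c 0 + p • R := by
  intro P hP
  obtain ⟨u, R, hR, h⟩ := hGEN0 P hP
  obtain ⟨a, b, hab⟩ := exists_int_combination_eq_one_of_coprime hN
  -- `p = 2t + 1`
  obtain ⟨t, ht⟩ := (hp.out.eq_two_or_odd'.resolve_left hp2)
  refine ⟨a * u * t, a • R + b • P + (a * u) • cneg,
    add_mem (add_mem (AddSubgroup.zsmul_mem _ hR a) (AddSubgroup.zsmul_mem _ hP b)) (AddSubgroup.zsmul_mem _ hcneg _), ?_⟩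
  have key : P = a • (N • P) + b • (p • P) := by
    conv_lhs => rw [← one_zsmul P, ← hab]
    rw [add_zsmul, mul_comm (N : ℤ) a, mul_zsmul, natCast_zsmul, mul_comm (p : ℤ) b, mul_zsmul, natCast_zsmul]
  have hpt : (p : ℤ) = 2 * t + 1 := by exact_mod_cast ht
  conv_lhs => rw [key, h]
  rw [hR0]
  match_scalars <;> first | ring1 | linear_combination (-(a * u)) * hpt

end Clauses

/-! ## §3 `Sel⁺(E/ℚ_∞) = Sel♭(E/ℚ_∞)` at an odd supersingular prime, modulo a TP2-shape Honda system -/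

section Odd

variable (W : WeierstrassCurve ℚ) [W.IsElliptic] [W.IsGloballyMinimal] {p : ℕ} [hp : Fact p.Prime]

/-- **`Sel⁺(E/ℚ_∞) = Sel♭(E/ℚ_∞)` AT AN ODD SUPERSINGULAR PRIME, modulo a TP2-shape Honda system** — the odd-`p` twin of
`SignedKatoOffTwo.FlatKernel.signedSelmerInfty_eq_sharpFlatSelmerInfty_flat_two`. For `W/ℚ` globally minimal, `p ≠ 2` good with `p ∣ a_p`,
the CYCLOTOMIC `κ`, the place `v ∋ p`, a local lift `g` of the topological generator and a Honda system `d` of `a_p = 0` shape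
((L) (TR) (GEN) (GEN₀)): Kobayashi's and Sprung's Selmer groups over `ℚ_∞` coincide. (NT) is Sprung's Lemma 2.3
(`Sprung2012.eq_zero_of_mem_localTowerPointsOfEmb_of_prime_nsmul`), (IDX) the layer degrees
(`SignedEC.index_subgroupOf_localLayerSubgroupOfEmb_succ_eq`), `≤` is the generic `signedSelmerInfty_le_sharpFlatSelmerInfty_flat`, `≥` is
the generic local exact-annihilator inclusion + the descent of §1. [cite: Kobayashi2003, Def. 1.1, Thm. 6.2, Prop. 8.18–8.23]
[cite: Sprung2012, §1 p. 1486, Def. 7.9–7.11 (p. 1503), Lemma 2.3 (p. 1487)] -/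
theorem signedSelmerInfty_one_eq_sharpFlatSelmerInfty_flat_odd (hp2 : p ≠ 2) (hgood : W.HasGoodReductionAtPrime p)
    (hap : (p : ℤ) ∣ W.frobeniusTrace p) (κ : ZpExtension ℚ p) (hκ : κ.IsCyclotomic)
    (v : HeightOneSpectrum (𝓞 ℚ)) (hv : (p : 𝓞 ℚ) ∈ v.asIdeal)
    {g : Field.absoluteGaloisGroup (v.adicCompletion ℚ)}
    (hg : κ.IsTopGenerator (resGalOfEmb (closureEmb (K := ℚ) (v.adicCompletion ℚ)) g))
    {d : ℕ → localPoints W (v.adicCompletion ℚ)}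
    (hd : ∀ m, d m ∈ localLayerPoints κ (v.adicCompletion ℚ) W m)
    (htr : ∀ m, localTrace κ (v.adicCompletion ℚ) W (m + 1) (m + 2) (d (m + 2)) = -d m)
    (hgen : ∀ m : ℕ, 1 ≤ m → ∀ P ∈ localLayerPoints κ (v.adicCompletion ℚ) W m,
      ∃ B ∈ AddSubgroup.closure (Set.range fun σ : Field.absoluteGaloisGroup (v.adicCompletion ℚ) ↦ σ • d m),
        ∃ P' ∈ localLayerPoints κ (v.adicCompletion ℚ) W (m - 1),
          ∃ R ∈ localLayerPoints κ (v.adicCompletion ℚ) W m, P = B + P' + p • R)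
    (hgen0 : ∀ P ∈ localLayerPoints κ (v.adicCompletion ℚ) W 0,
      ∃ a : ℤ, ∃ R ∈ localLayerPoints κ (v.adicCompletion ℚ) W 0, P = a • d 0 + p • R) :
    signedSelmerInfty W κ 1 = sharpFlatSelmerInfty W κ (closureEmb (K := ℚ) (v.adicCompletion ℚ)) 0 g d .flat := by
  -- (NT): Sprung's Lemma 2.3
  have hnt : ∀ P ∈ localTowerPointsOfEmb κ (closureEmb (K := ℚ) (v.adicCompletion ℚ)) W, p • P = 0 → P = 0 :=
    fun P hP hpP ↦ Sprung2012.eq_zero_of_mem_localTowerPointsOfEmb_of_prime_nsmul W p hp2 hgood hap κ hv _ hP hpP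
  refine le_antisymm
    (signedSelmerInfty_le_sharpFlatSelmerInfty_flat W κ v hv hg hnt
      (SignedEC.index_subgroupOf_localLayerSubgroupOfEmb_succ_eq hκ v hv) hd htr hgen hgen0)
    (fun s hs ↦ ?_)
  refine mem_signedSelmerInfty_of_mem_selmerInfty_of_kummer W κ 1 s
    (sharpFlatSelmerInfty_le_selmerInfty W κ _ 0 g d .flat hs) fun v' hv' σ ↦ ?_
  obtain rfl : v = v' := heightOneSpectrum_eq_of_natCast_mem hp.out hv (by exact_mod_cast hv')
  exact conjH1_mem_localKummerOverOfEmb_iSup_plus_of_mem_sharpFlatSelmerInfty W κ _ hg hnt hd htr hs σ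

/-! ## §4 The `ε = 1` instance of TRANSPORT, with its Honda system, unconditionally -/

/-- **TRANSPORT for `ε = +1` at an odd supersingular prime with `a_p = 0` — UNCONDITIONAL.** For `W/ℚ` elliptic, globally minimal,
`p ≠ 2` good with `a_p = 0`, the cyclotomic `κ` and the place `v ∋ p`: there are a local lift `g` of the topological generator, a
Honda system `(cneg, c)` in Sprung's sense (`IsHondaSystem κ (closureEmb ℚ_v) W a_p g cneg c` — Thm. 2.2, the tree theorem of seat
honda-p1, rebuilt here from its primal data so that the SAME `c` serves both sides) and
`Sel⁺(E/ℚ_∞) = Sel♭(E/ℚ_∞)` for it (`Kobayashi2003.signedSelmerInfty W κ 1 = Sprung2012.sharpFlatSelmerInfty W κ (closureEmb ℚ_v) a_p g c ♭`).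
This is the hypothesis `hT` of `KimCor315.cor315_of_poitouTate_of_signedEqChromatic` AT THE SIGN `ε = 1`; the sign `ε = −1`
(colour `♯`) is not covered. [cite: Sprung2012, §1 p. 1486, Thm. 2.2 (p. 1487), Def. 7.9–7.11]
[cite: Kobayashi2003, Def. 1.1, Thm. 6.2, Prop. 8.12, Prop. 8.18–8.23] -/
theorem exists_isHondaSystem_signedSelmerInfty_one_eq_flat (hp2 : p ≠ 2) (hgood : W.HasGoodReductionAtPrime p)
    (hap : W.frobeniusTrace p = 0) (κ : ZpExtension ℚ p) (hκ : κ.IsCyclotomic)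
    (v : HeightOneSpectrum (𝓞 ℚ)) (hv : (p : 𝓞 ℚ) ∈ v.asIdeal) :
    ∃ (g : Field.absoluteGaloisGroup (v.adicCompletion ℚ)) (cneg : localPoints W (v.adicCompletion ℚ))
      (c : ℕ → localPoints W (v.adicCompletion ℚ)),
      κ.IsTopGenerator (resGalOfEmb (closureEmb (K := ℚ) (v.adicCompletion ℚ)) g) ∧
      IsHondaSystem κ (closureEmb (K := ℚ) (v.adicCompletion ℚ)) W (W.frobeniusTrace p) g cneg c ∧
      signedSelmerInfty W κ 1 =
        sharpFlatSelmerInfty W κ (closureEmb (K := ℚ) (v.adicCompletion ℚ)) (W.frobeniusTrace p) g c .flat := by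
  have hap' : (p : ℤ) ∣ W.frobeniusTrace p := by rw [hap]; exact dvd_zero _
  -- a local lift of the generator and the primal Honda data over `ℚ_v` (seat honda-p1)
  obtain ⟨g, hg⟩ := ZpExtension.IsCyclotomic.exists_isTopGenerator_resGalOfEmb_adicCompletion hκ v hv
  obtain ⟨cneg, c, N, hN, hcneg, hc, hR0, hR1, hRn, hGEN, hGEN0⟩ :=
    SprungHonda.primalHonda_adicCompletion_of_padic W κ (W.frobeniusTrace p) v hv
      (fun ι ↦ SprungHonda.exists_primalHonda_padic W hp2 hgood hap' κ hκ ι)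
  refine ⟨g, cneg, c, hg, SprungHonda.isHondaSystem_of_primal κ (closureEmb (K := ℚ) (v.adicCompletion ℚ)) W
    (SprungHonda.intCast_sub_two_isUnit_of_dvd hp2 hap').2 hg hN hcneg hc hR0 hR1 hRn hGEN hGEN0, ?_⟩
  -- the TP2-shape clauses for `d := c` at `a_p = 0`
  have htr : ∀ m, localTrace κ (v.adicCompletion ℚ) W (m + 1) (m + 2) (c (m + 2)) = -c m := fun m ↦ by
    have h := hRn (m + 1) (Nat.succ_le_succ (Nat.zero_le m))
    rw [hap, zero_smul, zero_sub, Nat.add_sub_cancel] at h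
    exact h
  have hR0' : c 0 = (-2 : ℤ) • cneg := by rw [hR0, hap, zero_sub]
  rw [hap]
  exact signedSelmerInfty_one_eq_sharpFlatSelmerInfty_flat_odd W hp2 hgood hap' κ hκ v hv hg hc htr
    (gen_of_gen_nsmul κ _ W hN hGEN) (gen_zero_of_gen_zero_nsmul κ _ W hp2 hN hcneg hR0' hGEN0)

end Odd

/-! ## §5 B. D. Kim's Cor. 3.15 for the PLUS sign from the generic Poitou–Tate rows over `ℚ` ALONE -/

section Plus

open Literature.NumberTheory.GaloisCohomology Literature.NumberTheory.EllipticCurves.IwasawaAlgebra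
open Summit.BirchSwinnertonDyer.Rank1Residual.X11b (LocBridge.primaryGaloisModule)
open Literature.NumberTheory.GaloisRepresentations.DiscreteGaloisModule (shaTwo)

/-- **B. D. Kim 2013 Cor. 3.15 for the sign `+` (`F = ℚ`, `p` odd, `a_p = 0`) — the body of `BDKim2013.cor315_signedCharValue_rankZero`
at `ε = 1` — from CASSELS by name and the three generic Poitou–Tate rows over `ℚ`, NOTHING ELSE displayed**: for `W/ℚ` elliptic and
globally minimal, `p ≠ 2` good with `a_p = 0`, cyclotomic `κ` with topological generator `γ`, any Pontryagin-dual datum `D` of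
`Sel⁺(E/ℚ_∞)`, any generator `f` of `char X⁺` and `Sel_{p^∞}(E/ℚ)` finite: `f(0) = u · p^{ord_p ∏ c_v} · #Sel_{p^∞}(E/ℚ)`, `u ∈ ℤ_pˣ`
(and `X⁺` is `Λ`-torsion — the displayed torsion hypothesis of the fact is idle). The plus Honda system and the identity
`Sel⁺_∞ = Sel♭_∞` of §4 feed `KimCor315.cor315_body_of_cassels_of_poitouTate_of_honda_of_eq`. Kim's Thm. 3.14 and «`g_v` injective»
are NOT hypotheses. [cite: BDKim2013, Cor. 3.15 (p. 199) and proof (pp. 199–200)] [cite: GreenbergLNM1716, §4 Prop. 4.13 (p. 122)]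
[cite: MilneADT2006, Ch. I, Thm. 4.10 (a),(c), Cor. 4.16] [cite: Sprung2012, §1 p. 1486, Thm. 2.2] -/
theorem cor315_plus_of_cassels_of_poitouTate (hC : Greenberg1999.casselsSurjectivity_H1Sigma ℚ)
    (hPT : poitouTate_sha_tateDual ℚ) (h3 : poitouTate_three_realPlaces_injective ℚ)
    (h2 : poitouTate_two_realPlaces_surjective ℚ)
    (W : WeierstrassCurve ℚ) [W.IsElliptic] [W.IsGloballyMinimal] (p : ℕ) [Fact p.Prime]
    (hp2 : p ≠ 2) (hgood : W.HasGoodReductionAtPrime p) (hap : W.frobeniusTrace p = 0)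
    (κ : ZpExtension ℚ p) {γ : Field.absoluteGaloisGroup ℚ} (hκ : κ.IsCyclotomic) (hγ : κ.IsTopGenerator γ)
    (D : SignedSelmerDualData W κ γ 1) (f : IwasawaAlgebra p) (hf : D.charIdeal = Ideal.span {f})
    (hSel : Finite (W.selmerGroupPInfty p)) :
    Module.IsTorsion (IwasawaAlgebra p) D.X ∧
      ∃ u : ℤ_[p]ˣ,
        ((PowerSeries.constantCoeff f : ℤ_[p]) : ℚ_[p]) =
          ((u : ℤ_[p]) : ℚ_[p]) * (p : ℚ_[p]) ^ (padicValNat p W.tamagawaProduct) *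
            (Nat.card (W.selmerGroupPInfty p) : ℚ_[p]) := by
  obtain ⟨v, hv⟩ : ∃ v : HeightOneSpectrum (𝓞 ℚ), ((p : ℕ) : 𝓞 ℚ) ∈ v.asIdeal :=
    Literature.NumberTheory.EllipticCurves.exists_heightOneSpectrum_natCast_mem (K := ℚ) (Fact.out : p.Prime)
  obtain ⟨g, cneg, c, hg, hH, heq⟩ :=
    exists_isHondaSystem_signedSelmerInfty_one_eq_flat W hp2 hgood hap κ hκ v (by exact_mod_cast hv)
  exact cor315_body_of_cassels_of_poitouTate_of_honda_of_eq hC hPT h3 h2 hp2 hgood hap hκ hγ D (by exact_mod_cast hv)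
    hg hH heq hSel f hf

/-- **The same from the FOUR generic Poitou–Tate rows over `ℚ`** (CASSELS discharged to `poitouTate_selmerStructure_duality ℚ`,
`SignedEC.CasselsPT.casselsSurjectivity_H1Sigma_of_poitouTate`): Cor. 3.15 for the sign `+` rests on {Milne I 4.10 for Selmer
structures, 4.10 (a), 4.10 (c)₃, 4.16} — the base of rows 1/7/8 — and on no `±`-specific input.
[cite: BDKim2013, Cor. 3.15 (p. 199)] [cite: MilneADT2006, Ch. I, Thm. 4.10, Cor. 4.16, Thm. 6.13] [cite: Cassels1964ArithmeticVII] -/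
theorem cor315_plus_of_poitouTate (hPTs : poitouTate_selmerStructure_duality ℚ)
    (hPT : poitouTate_sha_tateDual ℚ) (h3 : poitouTate_three_realPlaces_injective ℚ)
    (h2 : poitouTate_two_realPlaces_surjective ℚ)
    (W : WeierstrassCurve ℚ) [W.IsElliptic] [W.IsGloballyMinimal] (p : ℕ) [Fact p.Prime]
    (hp2 : p ≠ 2) (hgood : W.HasGoodReductionAtPrime p) (hap : W.frobeniusTrace p = 0)
    (κ : ZpExtension ℚ p) {γ : Field.absoluteGaloisGroup ℚ} (hκ : κ.IsCyclotomic) (hγ : κ.IsTopGenerator γ)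
    (D : SignedSelmerDualData W κ γ 1) (f : IwasawaAlgebra p) (hf : D.charIdeal = Ideal.span {f})
    (hSel : Finite (W.selmerGroupPInfty p)) :
    Module.IsTorsion (IwasawaAlgebra p) D.X ∧
      ∃ u : ℤ_[p]ˣ,
        ((PowerSeries.constantCoeff f : ℤ_[p]) : ℚ_[p]) =
          ((u : ℤ_[p]) : ℚ_[p]) * (p : ℚ_[p]) ^ (padicValNat p W.tamagawaProduct) *
            (Nat.card (W.selmerGroupPInfty p) : ℚ_[p]) :=
  cor315_plus_of_cassels_of_poitouTate (SignedEC.CasselsPT.casselsSurjectivity_H1Sigma_of_poitouTate hPTs) hPT h3 h2 W p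
    hp2 hgood hap κ hκ hγ D f hf hSel

end Plus

end Summit.BirchSwinnertonDyer.BirchSwinnertonDyer.Theorems.KimCor315

end
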